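import Summits.SmoothPoincare4.SmoothPoincare4.Theorems.EntropyRungSubcylindricalExistenceTheoremA
import Summits.SmoothPoincare4.SmoothPoincare4.Theorems.RicciFatSpc4ImpliesRicciFatSphere
import HarnessLib

/-!
# The crux `EntropyRung.SubcylindricalExistence` is EQUIVALENT to route RicciFat's crux
`RicciFat.RicciFatSphere` given the rung (certificate of the ledger state
`blocked-on: stmt-SmoothPoincare4-5192` of item stmt-SmoothPoincare4-10871)

Two cruxes of two different routes on `SmoothPoincare4` are the same proposition modulo the rung
`EntropyRung.SubcylindricalRecognition` (stmt-SmoothPoincare4-10869):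

* `RicciFatSphere → SubcylindricalExistence` is the tree theorem
  `subcylindricalExistence_of_ricciFatSphere` (Theorem A of line `curvature-dimension-entropy-floor`
  at `δ = 1/50`; unconditional) — so ENT (stmt-10871) closes in one line the moment
  `RicciFatSphere` (stmt-5192) lands;
* `SubcylindricalExistence → RicciFatSphere` given the rung: ENT and the rung give `SmoothPoincare4`
  (the route's deciding theorem `EntropyRung.closes`), and `SmoothPoincare4 → RicciFatSphere` is the
  proved support item stmt-SmoothPoincare4-5193 (`spc4ImpliesRicciFatSphere_proof`: the round metric
  pulled back along the diffeomorphism).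

Hence `subcylindricalExistence_iff_ricciFatSphere` and `ricciFatSphere_iff_spc4` (both given the
rung): parking stmt-10871 on stmt-5192 loses nothing and gains nothing beyond SPC4 itself. Everything
is proved (no `sorry`, no definition, no named fact); the rung enters only as an explicit hypothesis.

References: [CaoHamiltonIlmanen2004] Thm 3.4; [BakryGentilLedoux2014] §6; [CheegerColding1997] (context).
-/

noncomputable section

-- the registered namespace `Summit.SmoothPoincare4.SmoothPoincare4.Theorems` repeats a component
set_option linter.dupNamespace false

namespace Summit.SmoothPoincare4.SmoothPoincare4.Theorems

/-- **ENT and the rung give route RicciFat's crux.** `SubcylindricalRecognition → SubcylindricalExistence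
→ RicciFatSphere`: the route's deciding theorem `closes` yields `SmoothPoincare4`, and the proved support
item stmt-SmoothPoincare4-5193 (`spc4ImpliesRicciFatSphere_proof`) transports the round metric.
[folklore] -/
theorem ricciFatSphere_of_subcylindricalExistence :
    _root_.Summit.SmoothPoincare4.SmoothPoincare4.Theses.EntropyRung.SubcylindricalRecognition →
      _root_.Summit.SmoothPoincare4.SmoothPoincare4.Theses.EntropyRung.SubcylindricalExistence →
      _root_.Summit.SmoothPoincare4.SmoothPoincare4.Theses.RicciFat.RicciFatSphere :=
  fun hRung hEnt ↦ spc4ImpliesRicciFatSphere_proof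
    (_root_.Summit.SmoothPoincare4.SmoothPoincare4.Theses.EntropyRung.closes hRung hEnt)

/-- **The two cruxes coincide modulo the rung**: given `SubcylindricalRecognition`
(stmt-SmoothPoincare4-10869), `EntropyRung.SubcylindricalExistence` (stmt-SmoothPoincare4-10871) holds
iff `RicciFat.RicciFatSphere` (stmt-SmoothPoincare4-5192) does. `←` is unconditional
(`subcylindricalExistence_of_ricciFatSphere`). [folklore] -/
theorem subcylindricalExistence_iff_ricciFatSphere :
    _root_.Summit.SmoothPoincare4.SmoothPoincare4.Theses.EntropyRung.SubcylindricalRecognition →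
      (_root_.Summit.SmoothPoincare4.SmoothPoincare4.Theses.EntropyRung.SubcylindricalExistence ↔
        _root_.Summit.SmoothPoincare4.SmoothPoincare4.Theses.RicciFat.RicciFatSphere) :=
  fun hRung ↦ ⟨ricciFatSphere_of_subcylindricalExistence hRung, subcylindricalExistence_of_ricciFatSphere⟩

/-- **`RicciFatSphere ⇔ SPC4` given the rung of route EntropyRung**: `→` through ENT
(`subcylindricalExistence_of_ricciFatSphere`, then `closes`), `←` is stmt-SmoothPoincare4-5193. So the
item stmt-5192 on which stmt-10871 is parked is itself the summit modulo the rung. [folklore] -/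
theorem ricciFatSphere_iff_spc4 :
    _root_.Summit.SmoothPoincare4.SmoothPoincare4.Theses.EntropyRung.SubcylindricalRecognition →
      (_root_.Summit.SmoothPoincare4.SmoothPoincare4.Theses.RicciFat.RicciFatSphere ↔ _root_.SmoothPoincare4) :=
  fun hRung ↦ ⟨fun h ↦ _root_.Summit.SmoothPoincare4.SmoothPoincare4.Theses.EntropyRung.closes hRung
      (subcylindricalExistence_of_ricciFatSphere h),
    spc4ImpliesRicciFatSphere_proof⟩

end Summit.SmoothPoincare4.SmoothPoincare4.Theorems

end
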